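import Summits.ResolutionOfSingularities.ResolutionOfSingularities.Theorems.HilbertSamuelEliminationSigmaMaxModificationsCorridor3SigmaSharedGame2Core

/-!
# PART 2 (§3–§5) of the hoist of res-L1-w42-idea-2 r12 `SharedGame2-r12.lean` 04badbd0b10fd4bb — potential, TERMINATION, sharpness
# (PART 1 = `…Corridor3SigmaSharedGame2Core`: the game, the rows, the crossing weight; filing seat res-D-pv-002 g4, authorship idea-2 g11)

# L2′ PROVED (r12) — the shared divisor-first face game along Γ = D_u ∩ D_v terminates, for every order of play

[OURS · L1 W4.2 · crux stmt-ResolutionOfSingularities-18506 / conjunct 19249 · IDEATOR 2 (res-L1-w42-idea-2) gen 11, r12 · counted 0 ·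
row of record `SharedPlayFiniteDivisorFirstNE` (r11, tri-1 TRIAGE v6.5 §R13-I2 repair of the r10 row); r11 file `sigma-r11/SharedGame2-r11.lean`]

THEOREM (this file, no `sorry`): `sharedPlayFiniteDivisorFirstNE_holds : SharedPlayFiniteDivisorFirstNE`, obtained from the stronger
`no_infinite_dfPlay`: for EVERY nonempty finite `B ⊂ ℤ²` (no sign condition), every marking `m ≥ 1` and EVERY starting fan, there is no
infinite sequence of divisor-first legal moves — in particular termination does not depend on the ORDER in which the sites sharing Γ impose
their moves (bears on CRUX-PLAN (GN′)/r-66 in the dim-2 shadow).  Sharpness: `not_sharedPlayFiniteDivisorFirst` (B = ∅, tri-1) and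
`freePlay_infinite` (B = {(1,0)}, m = 1: WITHOUT the divisor-first discipline the pair move can be played for ever) — both binders of the row are needed.

PROOF IDEA (new in r12; replaces the sector/Stern–Brocot sketch of r11).  Two potentials on the fan `L = (r₀, …, r_k)`, rays `rᵢ = (vᵢ, bᵢ)`:
* the CROSSING WEIGHT of a cone `(v, v′)`:  `D(v,v′) := Σ_{(a,a′) ∈ B×B, ⟨a−a′,v⟩ > 0 > ⟨a−a′,v′⟩} (⟨a−a′,v⟩ − ⟨a−a′,v′⟩) ≥ 0` — the total amount by
  which the two rays DISAGREE on the order of the cloud.  Under ANY subdivision `(v,v′) ↦ (v,v+v′), (v+v′,v′)` it splits sub-additively and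
  STRICTLY when positive (`D_split_lt`: a separated pair `x > 0 > y` survives in at most one child, with weight `−y < x−y` or `x < x−y`), and
  `D = 0` forces a COMMON MINIMISER `a* ∈ B` of `⟨·,v⟩` and `⟨·,v′⟩` (`exists_common_min`), whence `h(v+v′) = h(v) + h(v′)` for the support
  function `h(v) := min_{a∈B} ⟨a,v⟩`;
* the RESIDUE `μ(r) := h(v) − m·b` of a ray.  On a `D = 0` cone a divisor-first pair move has `μ(r), μ(r′) < m ≤ μ(r) + μ(r′)` (the two
  singletons are illegal, the pair is legal at `a*`), so the new ray has `μ″ = μ + μ′ − m` with `0 ≤ μ″ < min(μ, μ′)`.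
The cone potential `F(r,r′) := 3^e`, `e := m+1+D(v,v′)` if `D > 0`, else `e := min(μ(r), μ(r′), m)`, summed over adjacent cones (`P1`), drops
STRICTLY at every pair move (`3^{e₁} + 3^{e₂} < 3^{e}` when `e₁, e₂ < e`) and weakly at every singleton move; `P2 := Σ μ` drops strictly (by `m`)
at every singleton move.  An infinite play would make `P1` eventually constant, after which only singleton moves occur and `P2` decreases for ever.
NOT a statement of the manuscript under review; AI ideation, weaker than expert review.
-/

set_option linter.dupNamespace false -- mandated `Summit.ResolutionOfSingularities.ResolutionOfSingularities` prefix of this single-conjunct summit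

namespace Summit.ResolutionOfSingularities.ResolutionOfSingularities.Cruxes.SigmaMaxModifications.IdeasL1Idea2R12.SharedGame2

/-! ## §3 The potential -/

/-- `3^a + 3^b < 3^c` for `a, b < c`.  [OURS · plumbing] -/
theorem three_pow_add_lt {a b c : ℕ} (ha : a < c) (hb : b < c) : 3 ^ a + 3 ^ b < 3 ^ c := by
  obtain ⟨k, rfl⟩ : ∃ k, c = k + 1 := ⟨c - 1, by omega⟩
  have h1 : 3 ^ a ≤ 3 ^ k := Nat.pow_le_pow_right (by norm_num) (by omega)
  have h2 : 3 ^ b ≤ 3 ^ k := Nat.pow_le_pow_right (by norm_num) (by omega)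
  have h3 : 0 < 3 ^ k := pow_pos (by norm_num) k
  rw [pow_succ]; omega

section Potential
variable (B : Finset (ℤ × ℤ)) (m : ℤ)

/-- Exponent of the cone potential: `m+1+D` on a crossed cone, `min(μ, μ′, m)` on an uncrossed one.  [OURS] -/
def expo (r s : Ray2) : ℕ :=
  if 0 < D B r.v s.v then m.toNat + 1 + (D B r.v s.v).toNat else min (min (muN B m r) (muN B m s)) m.toNat

/-- Cone potential `3^e`.  [OURS] -/
def F (r s : Ray2) : ℕ := 3 ^ expo B m r s

/-- Sum of cone potentials of `p :: L` over adjacent pairs, with left neighbour `p`.  [OURS] -/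
def P1' : Ray2 → List Ray2 → ℕ
  | _, [] => 0
  | p, r :: L => F B m p r + P1' r L

/-- `P1(L)` = sum of the cone potentials over adjacent pairs of the fan `L`.  [OURS] -/
def P1 : List Ray2 → ℕ
  | [] => 0
  | r :: L => P1' B m r L

/-- Junction term between a prefix and the next ray.  [OURS] -/
def junc : List Ray2 → Ray2 → ℕ
  | [], _ => 0
  | t :: L, r => F B m ((t :: L).getLast (List.cons_ne_nil t L)) r

/-- `P2(L)` = sum of the truncated residues.  [OURS] -/
def P2 (L : List Ray2) : ℕ := (L.map (muN B m)).sum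

variable {B m}

/-- `P1'` over a concatenation.  [OURS · plumbing] -/
theorem P1'_append (p : Ray2) (L₁ L₂ : List Ray2) :
    P1' B m p (L₁ ++ L₂) = P1' B m p L₁ + P1' B m ((p :: L₁).getLast (List.cons_ne_nil p L₁)) L₂ := by
  induction L₁ generalizing p with
  | nil => simp [P1']
  | cons t L ih => simp only [List.cons_append, P1', ih t, List.getLast_cons_cons]; ring

/-- `P1` splits at an inserted ray: prefix + junction + suffix.  [OURS · plumbing] -/
theorem P1_append_cons (L₁ : List Ray2) (r : Ray2) (M : List Ray2) :
    P1 B m (L₁ ++ r :: M) = P1 B m L₁ + junc B m L₁ r + P1' B m r M := by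
  cases L₁ with
  | nil => simp [P1, junc]
  | cons t L => simp only [List.cons_append, P1, junc, P1'_append, P1']; ring

/-- `P2` splits at an inserted ray.  [OURS · plumbing] -/
theorem P2_append_cons (L₁ : List Ray2) (r : Ray2) (M : List Ray2) :
    P2 B m (L₁ ++ r :: M) = P2 B m L₁ + muN B m r + P2 B m M := by
  simp only [P2, List.map_append, List.map_cons, List.sum_append, List.sum_cons]; ring

/-- The exponent is at most `m + 1 + D`.  [OURS · plumbing] -/
theorem expo_le (r s : Ray2) : expo B m r s ≤ m.toNat + 1 + (D B r.v s.v).toNat := by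
  unfold expo; split_ifs with h
  · exact le_rfl
  · exact (min_le_right _ _).trans (by omega)

/-! ### singleton moves: `P1` weakly down, `P2` strictly down -/

/-- A singleton move does not raise the truncated residue.  [OURS · proved] -/
theorem muN_single_le (hm : 0 ≤ m) (r : Ray2) : muN B m ⟨r.v, r.b + 1⟩ ≤ muN B m r := by
  unfold muN; rw [mu_single]; exact Int.toNat_le_toNat (by linarith)

/-- A LEGAL singleton move lowers the truncated residue.  [OURS · proved] -/
theorem muN_single_lt (hB : B.Nonempty) (hm : 1 ≤ m) {r : Ray2} (h : SingletonLegal B m r) :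
    muN B m ⟨r.v, r.b + 1⟩ < muN B m r := by
  unfold muN; rw [mu_single]
  have := m_le_mu_of_singletonLegal hB h
  exact (Int.toNat_lt_toNat (by omega)).2 (by omega)

/-- A singleton move on the left ray does not raise the exponent.  [OURS · proved] -/
theorem expo_single_left (hm : 0 ≤ m) (r s : Ray2) : expo B m ⟨r.v, r.b + 1⟩ s ≤ expo B m r s := by
  have hμ := muN_single_le (B := B) hm r
  unfold expo; dsimp only
  split_ifs
  · exact le_rfl
  · exact min_le_min (min_le_min hμ le_rfl) le_rfl

/-- A singleton move on the right ray does not raise the exponent.  [OURS · proved] -/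
theorem expo_single_right (hm : 0 ≤ m) (q r : Ray2) : expo B m q ⟨r.v, r.b + 1⟩ ≤ expo B m q r := by
  have hμ := muN_single_le (B := B) hm r
  unfold expo; dsimp only
  split_ifs
  · exact le_rfl
  · exact min_le_min (min_le_min le_rfl hμ) le_rfl

/-- A singleton move on the left ray does not raise the cone potential.  [OURS · proved] -/
theorem F_single_left (hm : 0 ≤ m) (r s : Ray2) : F B m ⟨r.v, r.b + 1⟩ s ≤ F B m r s :=
  Nat.pow_le_pow_right (by norm_num) (expo_single_left hm r s)

/-- A singleton move on the right ray does not raise the cone potential.  [OURS · proved] -/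
theorem F_single_right (hm : 0 ≤ m) (q r : Ray2) : F B m q ⟨r.v, r.b + 1⟩ ≤ F B m q r :=
  Nat.pow_le_pow_right (by norm_num) (expo_single_right hm q r)

/-- A singleton move on the head does not raise `P1'`.  [OURS · proved] -/
theorem P1'_single_le (hm : 0 ≤ m) (r : Ray2) (L : List Ray2) : P1' B m ⟨r.v, r.b + 1⟩ L ≤ P1' B m r L := by
  cases L with
  | nil => simp [P1']
  | cons s L => simp only [P1']; exact Nat.add_le_add_right (F_single_left hm r s) _

/-- A singleton move does not raise the junction term.  [OURS · proved] -/
theorem junc_single_le (hm : 0 ≤ m) (L : List Ray2) (r : Ray2) : junc B m L ⟨r.v, r.b + 1⟩ ≤ junc B m L r := by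
  cases L with
  | nil => simp [junc]
  | cons t L => simp only [junc]; exact F_single_right hm _ r

/-! ### pair moves: `P1` strictly down -/

/-- **The key inequality.** On a divisor-first legal pair move the two new cones have strictly smaller exponent than the old one.
[OURS · PROVED] -/
theorem expo_pair_lt (hB : B.Nonempty) (hm : 1 ≤ m) (r r' : Ray2) (hleg : PairLegal B m r r')
    (hr : ¬ SingletonLegal B m r) (hr' : ¬ SingletonLegal B m r') :
    expo B m r ⟨r.v + r'.v, r.b + r'.b + 1⟩ < expo B m r r' ∧ expo B m ⟨r.v + r'.v, r.b + r'.b + 1⟩ r' < expo B m r r' := by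
  by_cases hD : 0 < D B r.v r'.v
  · -- crossed cone: the crossing weight splits strictly
    have hsplit := D_split_lt B r.v r'.v hD
    have hn1 := D_nonneg B r.v (r.v + r'.v)
    have hn2 := D_nonneg B (r.v + r'.v) r'.v
    have e1 := expo_le (B := B) (m := m) r ⟨r.v + r'.v, r.b + r'.b + 1⟩
    have e2 := expo_le (B := B) (m := m) ⟨r.v + r'.v, r.b + r'.b + 1⟩ r'
    dsimp only at e1 e2
    have ep : expo B m r r' = m.toNat + 1 + (D B r.v r'.v).toNat := by unfold expo; rw [if_pos hD]
    rw [ep]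
    constructor <;> omega
  · -- uncrossed cone: common minimiser, residues add
    have hD0 : D B r.v r'.v = 0 := le_antisymm (not_lt.1 hD) (D_nonneg B r.v r'.v)
    obtain ⟨a, ha, h1, h2⟩ := exists_common_min hB r.v r'.v hD0
    have hv : hgt B r.v = ip a r.v := hgt_eq_of_min ha h1
    have hv' : hgt B r'.v = ip a r'.v := hgt_eq_of_min ha h2
    have hsum : hgt B (r.v + r'.v) = hgt B r.v + hgt B r'.v := hgt_add_eq hB _ _ hD0
    have hmu'' : mu B m ⟨r.v + r'.v, r.b + r'.b + 1⟩ = mu B m r + mu B m r' - m := by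
      simp only [mu]; rw [hsum]; ring
    have hlt_r : mu B m r < m := mu_lt_of_not_singletonLegal hr
    have hlt_r' : mu B m r' < m := mu_lt_of_not_singletonLegal hr'
    have hge : m ≤ mu B m r + mu B m r' := by
      have := hleg a ha; rw [sc_eq, sc_eq] at this; simp only [mu]; rw [hv, hv']; linarith
    have hc1 : ¬ 0 < D B r.v (r.v + r'.v) := by
      have := D_split_le B r.v r'.v; have := D_nonneg B (r.v + r'.v) r'.v; omega
    have hc2 : ¬ 0 < D B (r.v + r'.v) r'.v := by
      have := D_split_le B r.v r'.v; have := D_nonneg B r.v (r.v + r'.v); omega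
    have ep : expo B m r r' = min (min (muN B m r) (muN B m r')) m.toNat := by unfold expo; rw [if_neg hD]
    have e1 : expo B m r ⟨r.v + r'.v, r.b + r'.b + 1⟩ = min (min (muN B m r) (muN B m ⟨r.v + r'.v, r.b + r'.b + 1⟩)) m.toNat := by
      unfold expo; dsimp only; rw [if_neg hc1]
    have e2 : expo B m ⟨r.v + r'.v, r.b + r'.b + 1⟩ r' = min (min (muN B m ⟨r.v + r'.v, r.b + r'.b + 1⟩) (muN B m r')) m.toNat := by
      unfold expo; dsimp only; rw [if_neg hc2]
    rw [ep, e1, e2]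
    simp only [muN]
    rw [hmu'']
    constructor <;> omega

/-- A divisor-first PAIR move strictly lowers the cone potential (both children below the parent).  [OURS · proved] -/
theorem F_pair_lt (hB : B.Nonempty) (hm : 1 ≤ m) (r r' : Ray2) (hleg : PairLegal B m r r')
    (hr : ¬ SingletonLegal B m r) (hr' : ¬ SingletonLegal B m r') :
    F B m r ⟨r.v + r'.v, r.b + r'.b + 1⟩ + F B m ⟨r.v + r'.v, r.b + r'.b + 1⟩ r' < F B m r r' := by
  obtain ⟨h1, h2⟩ := expo_pair_lt hB hm r r' hleg hr hr'
  exact three_pow_add_lt h1 h2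

/-! ### one step -/

/-- **One divisor-first move:** a pair move lowers `P1` strictly; a singleton move lowers `P1` weakly and `P2` strictly.  [OURS · PROVED] -/
theorem potential_step (hB : B.Nonempty) (hm : 1 ≤ m) {L L' : List Ray2} (h : DFStep B m L L') :
    P1 B m L' < P1 B m L ∨ (P1 B m L' ≤ P1 B m L ∧ P2 B m L' < P2 B m L) := by
  cases h with
  | single L₁ L₂ r hleg =>
    right
    refine ⟨?_, ?_⟩
    · rw [P1_append_cons, P1_append_cons]
      have hj := junc_single_le (B := B) (by omega : 0 ≤ m) L₁ r
      have ht := P1'_single_le (B := B) (by omega : 0 ≤ m) r L₂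
      omega
    · rw [P2_append_cons, P2_append_cons]
      have := muN_single_lt hB hm hleg
      omega
  | pair L₁ L₂ r r' hleg hr hr' =>
    left
    rw [P1_append_cons, P1_append_cons]
    simp only [P1']
    have := F_pair_lt hB hm r r' hleg hr hr'
    omega

/-! ## §4 Termination -/

/-- **No infinite divisor-first play — for every nonempty `B ⊂ ℤ²`, every `m ≥ 1`, every starting fan.**  [OURS · PROVED] -/
theorem no_infinite_dfPlay (B : Finset (ℤ × ℤ)) (m : ℤ) (hB : B.Nonempty) (hm : 1 ≤ m) (f : ℕ → List Ray2)
    (hf : ∀ n, DFStep B m (f n) (f (n + 1))) : False := by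
  have key := fun n => potential_step hB hm (hf n)
  have anti1 : ∀ n, P1 B m (f (n + 1)) ≤ P1 B m (f n) := fun n => (key n).elim le_of_lt And.left
  have anti : ∀ n k, P1 B m (f (n + k)) ≤ P1 B m (f n) := by
    intro n k
    induction k with
    | zero => simp
    | succ k ih => exact (anti1 (n + k)).trans ih
  classical
  have hS : ∃ k, ∃ n, P1 B m (f n) = k := ⟨_, 0, rfl⟩
  obtain ⟨N, hN⟩ := Nat.find_spec hS
  have hmin : ∀ n, Nat.find hS ≤ P1 B m (f n) := fun n => Nat.find_min' hS ⟨n, rfl⟩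
  have hconst : ∀ j, P1 B m (f (N + j)) = Nat.find hS := fun j => le_antisymm (hN ▸ anti N j) (hmin _)
  have hdec : ∀ j, P2 B m (f (N + j)) + j ≤ P2 B m (f N) := by
    intro j
    induction j with
    | zero => simp
    | succ j ih =>
      have hc0 := hconst j
      have hc1 : P1 B m (f (N + j + 1)) = Nat.find hS := hconst (j + 1)
      show P2 B m (f (N + j + 1)) + (j + 1) ≤ P2 B m (f N)
      rcases key (N + j) with hlt | ⟨-, hlt2⟩
      · omega
      · omega
  have := hdec (P2 B m (f N) + 1)
  omega

end Potential

/-- **THEOREM (r12): the row of record `SharedPlayFiniteDivisorFirstNE` holds.**  [OURS · PROVED] -/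
theorem sharedPlayFiniteDivisorFirstNE_holds : SharedPlayFiniteDivisorFirstNE := by
  rintro B m hm hB - ⟨f, -, hf⟩
  exact no_infinite_dfPlay B m hB hm f hf

/-! ## §5 Sharpness: the divisor-first discipline is needed -/

/-- The undisciplined infinite play for `B = {(1,0)}`, `m = 1`: keep subdividing the cone next to `e_u`.  [OURS] -/
def freeRun : ℕ → List Ray2
  | 0 => [⟨(0, 1), 0⟩]
  | n + 1 => ⟨((n : ℤ) + 1, 1), (n : ℤ) + 1⟩ :: freeRun n

/-- **WITHOUT the divisor-first discipline the game need not terminate, even for a nonempty cloud.**  [OURS · PROVED] -/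
theorem freePlay_infinite :
    ∃ (B : Finset (ℤ × ℤ)) (m : ℤ), 1 ≤ m ∧ B.Nonempty ∧ (∀ a ∈ B, 0 ≤ a.1 ∧ 0 ≤ a.2) ∧
      ∃ f : ℕ → List Ray2, f 0 = initFan2 ∧ ∀ n, FreeStep B m (f n) (f (n + 1)) := by
  refine ⟨{((1 : ℤ), (0 : ℤ))}, 1, le_rfl, by simp, by simp, fun n => ⟨(1, 0), 0⟩ :: freeRun n, rfl, fun n => ?_⟩
  cases n with
  | zero =>
    have := FreeStep.pair (B := {((1 : ℤ), (0 : ℤ))}) (m := 1) [] [] ⟨(1, 0), 0⟩ ⟨(0, 1), 0⟩ (by decide)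
    simpa [freeRun] using this
  | succ n =>
    have := FreeStep.pair (B := {((1 : ℤ), (0 : ℤ))}) (m := 1) [] (freeRun n) ⟨(1, 0), 0⟩ ⟨((n : ℤ) + 1, 1), (n : ℤ) + 1⟩
      (by intro a ha; simp only [Finset.mem_singleton] at ha; subst ha; simp [sc])
    simp only [List.nil_append, freeRun] at this ⊢
    convert this using 3
    all_goals (try simp only [Prod.mk_add_mk])
    all_goals (try push_cast)
    all_goals (try ring_nf)

end Summit.ResolutionOfSingularities.ResolutionOfSingularities.Cruxes.SigmaMaxModifications.IdeasL1Idea2R12.SharedGame2
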